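import Summits.KontsevichZagierPeriods.KontsevichZagierPeriods.Theorems.AbelContractionRealHyperellipticSectorDefs
import Summits.KontsevichZagierPeriods.KontsevichZagierPeriods.Theorems.AbelContractionRealHyperellipticSectorEngineMPolyFactor
import Summits.KontsevichZagierPeriods.KontsevichZagierPeriods.Theorems.AbelContractionRealHyperellipticSectorEngineOvalSigns
import Summits.KontsevichZagierPeriods.KontsevichZagierPeriods.Theorems.AbelContractionRealHyperellipticSectorEngineRootGapSign

/-!
# Route AbelContraction — `RealHyperellipticSector` (crux stmt-KontsevichZagierPeriods-12475): the separating pencil, algebra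

Helper file of the line `Lines/birth.lean` toward the registered stub `stub_engine` (lead seat c2,
`--supports` the crux). THE MECHANISM (separating pencil / trace of `P dx/y`): for an M-polynomial
`q ∈ ℚ[X]` of degree `2g + 2` with negative leading coefficient `lc = −λ` and real simple roots
`e 0 < e 1 < ⋯ < e (2g+1)`, write `q = lc · N · D` with `N(t) = ∏_{k ≤ g} (t − e (2k))` and
`D(t) = ∏_{k ≤ g} (t − e (2k+1))`. The rational map `ψ = q/D² = −λN/D` carries every oval
`O_j = (e (2j), e (2j+1))` bijectively onto `(0, ∞)`, its fibre over `u > 0` being the zero set of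
the pencil `c_u = λN + uD`, which has exactly one simple root `x_j(u)` in each oval
(`engine_pencil_roots`). Pushing `[O_j, P/√q]` forward along `ψ` (one rule-2 move per oval) gives
integrands `h_j(u) = P(x_j)/(√q(x_j)·|ψ'(x_j)|) = (−1)^{g−j} P(x_j)/(√u · c_u'(x_j))` on the common
domain `(0, ∞)`, and `Σ_j (−1)^j h_j(u) = (−1)^g u^{-1/2} Σ_j P(x_j)/c_u'(x_j) = 0` by the Lagrange
interpolation identity (`deg P ≤ g − 1 = deg c_u − 2`): the trace of a form of the first kind under
`ψ : C → ℙ¹` vanishes. This file holds the pencil ALGEBRA: the Lagrange identity, the derivative of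
`ψ`, the identity `ψ'(x) = −c_u'(x)/D(x)` on the fibre, and the evaluation of the pushed-forward
integrands and of their signed sum. The moves are applied in `…StubEngine.lean`.

References: M. Kontsevich, D. Zagier, *Periods* (2001), §1.2 [KontsevichZagier2001];
B. Gross, J. Harris, *Real algebraic curves*, Ann. Sci. ÉNS 14 (1981), §3 [GrossHarris1981];
J.-L. Lagrange interpolation (Mathlib `Lagrange.coeff_eq_sum`). No definitions are introduced.
-/

noncomputable section

open Set Finset
open scoped Polynomial
open Literature.NumberTheory.Transcendental

namespace Summit.KontsevichZagierPeriods.AbelContraction.RealHyperellipticSector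

namespace Engine

/-! ## The Lagrange identity (trace of a form of the first kind) -/

/-- **Lagrange's identity** `Σ_j R(x_j)/∏_{m ≠ j} (x_j − x_m) = 0` for `n + 2` distinct nodes
`x_j` and `deg R ≤ n`: the sum is the coefficient of `X^{n+1}` of the interpolation polynomial of
`R` at the nodes, which is `R` itself (Mathlib `Lagrange.coeff_eq_sum`). [folklore] -/
theorem sum_eval_div_prod_sub_eq_zero {n : ℕ} (x : Fin (n + 2) → ℝ) (hx : Function.Injective x)
    (R : ℝ[X]) (hR : R.natDegree ≤ n) :
    ∑ j, R.eval (x j) / ∏ m ∈ univ.erase j, (x j - x m) = 0 := by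
  have hvs : Set.InjOn x (↑(univ : Finset (Fin (n + 2)))) := hx.injOn
  have hcard : #(univ : Finset (Fin (n + 2))) = n + 2 := by simp
  have hdeg : R.degree < #(univ : Finset (Fin (n + 2))) := by
    rw [hcard]
    exact (Polynomial.degree_le_natDegree).trans_lt
      (by exact_mod_cast (show R.natDegree < n + 2 by omega))
  have h := Lagrange.coeff_eq_sum hvs hdeg
  rw [hcard, show n + 2 - 1 = n + 1 by omega,
    Polynomial.coeff_eq_zero_of_natDegree_lt (by omega : R.natDegree < n + 1)] at h
  exact h.symm

/-- The derivative of `a · ∏_m (X − x_m)` at the node `x_j` is `a · ∏_{m ≠ j} (x_j − x_m)`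
(Mathlib `Lagrange.eval_nodal_derivative_eval_node_eq`). [folklore] -/
theorem derivative_C_mul_nodal_eval {ι : Type*} [Fintype ι] [DecidableEq ι] (x : ι → ℝ) (a : ℝ)
    (j : ι) :
    (Polynomial.derivative (Polynomial.C a * ∏ m, (Polynomial.X - Polynomial.C (x m)))).eval (x j) =
      a * ∏ m ∈ univ.erase j, (x j - x m) := by
  rw [show (∏ m, (Polynomial.X - Polynomial.C (x m)) : ℝ[X]) = Lagrange.nodal univ x from rfl,
    Polynomial.derivative_C_mul, Polynomial.eval_mul, Polynomial.eval_C,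
    Lagrange.eval_nodal_derivative_eval_node_eq (mem_univ j), Lagrange.eval_nodal]

/-! ## The derivative of `ψ = q/D²` and the fibre identity `ψ' = −c_u'/D` -/

/-- The derivative of `ψ(t) = q(t)/D(t)²` off the zeros of `D` (quotient rule):
`ψ'(t) = (q'(t) D(t) − 2 q(t) D'(t))/D(t)³`. [folklore] -/
theorem hasDerivAt_psi (qR DR : ℝ[X]) (t : ℝ) (hD : DR.eval t ≠ 0) :
    HasDerivAt (fun s => qR.eval s / (DR.eval s) ^ 2)
      ((qR.derivative.eval t * DR.eval t - 2 * qR.eval t * DR.derivative.eval t) /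
        (DR.eval t) ^ 3) t := by
  have hq := qR.hasDerivAt t
  have hD2 : HasDerivAt (fun s => (DR.eval s) ^ 2) (2 * DR.eval t * DR.derivative.eval t) t :=
    ((DR.hasDerivAt t).fun_pow 2).congr_deriv (by norm_num)
  refine (hq.fun_div hD2 (pow_ne_zero 2 hD)).congr_deriv ?_
  field_simp

/-- **The fibre identity.** With `q = −λ·N·D` and the pencil `c_u = λN + uD`: at a point `t` with
`D(t) ≠ 0` and `c_u(t) = 0` (i.e. `ψ(t) = u`), `ψ'(t) = −c_u'(t)/D(t)`. [folklore] -/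
theorem psi'_eq_of_pencil (NR DR : ℝ[X]) (lam u t : ℝ) (hD : DR.eval t ≠ 0)
    (hroot : lam * NR.eval t + u * DR.eval t = 0) :
    ((Polynomial.C (-lam) * NR * DR).derivative.eval t * DR.eval t -
        2 * (Polynomial.C (-lam) * NR * DR).eval t * DR.derivative.eval t) / (DR.eval t) ^ 3 =
      -((Polynomial.C lam * NR + Polynomial.C u * DR).derivative.eval t) / DR.eval t := by
  simp only [Polynomial.derivative_mul, Polynomial.derivative_C, zero_mul, zero_add,
    Polynomial.eval_add, Polynomial.eval_mul, Polynomial.eval_C, Polynomial.derivative_add]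
  rw [div_eq_div_iff (pow_ne_zero 3 hD) hD]
  have hu : u * DR.eval t = -(lam * NR.eval t) := by linarith
  have key : lam * NR.eval t * DR.derivative.eval t = -(u * DR.eval t) * DR.derivative.eval t := by
    rw [hu, neg_neg]
  linear_combination (DR.eval t) ^ 2 * key

/-! ## The ovals: signs, non-vanishing, and the fibre of `ψ` -/

/-- On the oval `O_j = (e (2j), e (2j+1))` of an M-configuration: `D ≠ 0`, `N ≠ 0` and
`−N·D > 0` (so `q = −λND > 0` for `λ > 0`). [cite: GrossHarris1981, §3] -/
theorem oval_ND (g : ℕ) (e : ℕ → ℝ) (he : StrictMono e) (j : ℕ) (hj : j ≤ g) (t : ℝ)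
    (ht : t ∈ Set.Ioo (e (2 * j)) (e (2 * j + 1))) :
    (∏ k ∈ range (g + 1), (t - e (2 * k + 1))) ≠ 0 ∧
      (∏ k ∈ range (g + 1), (t - e (2 * k))) ≠ 0 ∧
      0 < -((∏ k ∈ range (g + 1), (t - e (2 * k))) * ∏ k ∈ range (g + 1), (t - e (2 * k + 1))) := by
  obtain ⟨hN, hD⟩ := engine_oval_signs g e he j hj t ht
  refine ⟨fun h => ?_, fun h => ?_, ?_⟩
  · rw [h, mul_zero] at hD
    exact lt_irrefl _ hD
  · rw [h, mul_zero] at hN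
    exact lt_irrefl _ hN
  · have hprod := mul_pos hN hD
    have e1 : (-1 : ℝ) ^ (g - j) * (∏ k ∈ range (g + 1), (t - e (2 * k))) *
        ((-1 : ℝ) ^ (g - j + 1) * ∏ k ∈ range (g + 1), (t - e (2 * k + 1))) =
        -(((-1 : ℝ) ^ (g - j)) ^ 2 * ((∏ k ∈ range (g + 1), (t - e (2 * k))) *
          ∏ k ∈ range (g + 1), (t - e (2 * k + 1)))) := by ring
    rw [e1, show ((-1 : ℝ) ^ (g - j)) ^ 2 = 1 by rw [← pow_mul, mul_comm, pow_mul, neg_one_sq,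
      one_pow], one_mul] at hprod
    exact hprod

/-- The ovals are pairwise disjoint: a point of `O_j` which is one of the roots `x_m ∈ O_m` is
`x_j`. [folklore] -/
theorem eq_root_of_prod_eq_zero (g : ℕ) (e : ℕ → ℝ) (he : StrictMono e) (x : Fin (g + 1) → ℝ)
    (hx : ∀ m : Fin (g + 1), e (2 * (m : ℕ)) < x m ∧ x m < e (2 * (m : ℕ) + 1)) (j : Fin (g + 1))
    (t : ℝ) (ht : t ∈ Set.Ioo (e (2 * (j : ℕ))) (e (2 * (j : ℕ) + 1)))
    (h0 : ∏ m, (t - x m) = 0) : t = x j := by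
  obtain ⟨m, -, hm⟩ := Finset.prod_eq_zero_iff.mp h0
  have htm : t = x m := sub_eq_zero.mp hm
  rcases lt_trichotomy m j with hlt | rfl | hgt
  · exfalso
    have h1 : x m < e (2 * (m : ℕ) + 1) := (hx m).2
    have h2 : e (2 * (m : ℕ) + 1) ≤ e (2 * (j : ℕ)) :=
      he.monotone (by have := Fin.lt_def.mp hlt; omega)
    linarith [ht.1]
  · exact htm
  · exfalso
    have h1 : e (2 * (m : ℕ)) < x m := (hx m).1
    have h2 : e (2 * (j : ℕ) + 1) ≤ e (2 * (m : ℕ)) :=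
      he.monotone (by have := Fin.lt_def.mp hgt; omega)
    linarith [ht.2]

/-- **A point of the oval is the root of its own pencil**: if `q(t) = −λ N(t) D(t)` and `D(t) ≠ 0`
then `t` is a zero of `c_u` for `u = ψ(t) = q(t)/D(t)²`. [folklore] -/
theorem pencil_eq_zero_of_psi (lam N D q : ℝ) (hD : D ≠ 0) (hq : q = -lam * (N * D)) :
    lam * N + q / D ^ 2 * D = 0 := by
  rw [hq]
  field_simp
  ring

/-- **The value of `ψ` at a root of the pencil**: if `c_u(t) = λN(t) + uD(t) = 0`, `D(t) ≠ 0` and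
`q(t) = −λN(t)D(t)`, then `ψ(t) = q(t)/D(t)² = u`. [folklore] -/
theorem psi_eq_of_pencil_eq_zero (lam u N D q : ℝ) (hD : D ≠ 0) (hq : q = -lam * (N * D))
    (h0 : lam * N + u * D = 0) : q / D ^ 2 = u := by
  rw [hq, div_eq_iff (pow_ne_zero 2 hD)]
  linear_combination (-D) * h0

/-! ## The pushed-forward integrands and their signed sum -/

/-- **`√q = √u·|D|` on the fibre over `u`**: from `q = ψ·D²` with `ψ = u ≥ 0`. [folklore] -/
theorem sqrt_q_eq (u D q : ℝ) (hu : 0 ≤ u) (hq : q = u * D ^ 2) :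
    Real.sqrt q = Real.sqrt u * |D| := by
  rw [hq, Real.sqrt_mul hu, Real.sqrt_sq_eq_abs]

/-- **Evaluation of one pushed-forward integrand.** If `ψ'(x_j) = −A_j/D_j` with
`A_j = (λ+u)∏_{m≠j}(x_j − x_m)`, `(−1)^{g−j} ∏_{m≠j}(x_j − x_m) > 0`, `λ + u > 0`, `D_j ≠ 0`, `u > 0`
and `√q(x_j) = √u |D_j|`, then
`(P_j/√q(x_j))/|ψ'(x_j)| = (−1)^{g−j} P_j / (√u (λ+u) ∏_{m≠j}(x_j − x_m))`. [folklore] -/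
theorem pushforward_value (g j : ℕ) (Pj sq u lu Dj pr ψ' : ℝ) (hu : 0 < u) (hlu : 0 < lu)
    (hDj : Dj ≠ 0) (hpr : 0 < (-1 : ℝ) ^ (g - j) * pr) (hsq : sq = Real.sqrt u * |Dj|)
    (hψ' : ψ' = -(lu * pr) / Dj) :
    Pj / sq / |ψ'| = (-1 : ℝ) ^ (g - j) * Pj / (Real.sqrt u * (lu * pr)) := by
  have hsu : 0 < Real.sqrt u := Real.sqrt_pos.mpr hu
  have hDa : 0 < |Dj| := abs_pos.mpr hDj
  have habsψ : |ψ'| = lu * |pr| / |Dj| := by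
    rw [hψ', abs_div, abs_neg, abs_mul, abs_of_pos hlu]
  rw [habsψ, hsq]
  rcases neg_one_pow_eq_or ℝ (g - j) with h | h
  · rw [h, one_mul] at hpr ⊢
    rw [abs_of_pos hpr]
    field_simp
  · rw [h, neg_one_mul] at hpr ⊢
    have hpr' : pr < 0 := by linarith
    rw [abs_of_neg hpr']
    field_simp

/-- **The signed sum of the pushed-forward integrands vanishes**:
`Σ_j (−1)^j · (−1)^{g−j} P(x_j)/(√u (λ+u) ∏_{m≠j}(x_j − x_m)) = 0` for `deg P ≤ g − 1` and `g + 1`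
distinct nodes — the Lagrange identity `sum_eval_div_prod_sub_eq_zero` after pulling out the
common factor `(−1)^g/(√u(λ+u))`. [folklore] -/
theorem signed_sum_pushforward_eq_zero : ∀ {n : ℕ} (x : Fin (n + 2) → ℝ), Function.Injective x →
    ∀ (R : Polynomial ℝ), R.natDegree ≤ n → ∀ (c : ℝ),
      ∑ j : Fin (n + 2), (-1 : ℝ) ^ (j : ℕ) * ((-1 : ℝ) ^ (n + 1 - (j : ℕ)) * R.eval (x j) /
        (c * ∏ m ∈ Finset.univ.erase j, (x j - x m))) = 0 := by
  intro n x hx R hR c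
  have key := sum_eval_div_prod_sub_eq_zero x hx R hR
  have hterm : ∀ j : Fin (n + 2), (-1 : ℝ) ^ (j : ℕ) *
      ((-1 : ℝ) ^ (n + 1 - (j : ℕ)) * R.eval (x j) / (c * ∏ m ∈ univ.erase j, (x j - x m))) =
      ((-1 : ℝ) ^ (n + 1) / c) * (R.eval (x j) / ∏ m ∈ univ.erase j, (x j - x m)) := by
    intro j
    have hj : (j : ℕ) ≤ n + 1 := by have := j.isLt; omega
    have hpow : (-1 : ℝ) ^ (j : ℕ) * (-1 : ℝ) ^ (n + 1 - (j : ℕ)) = (-1 : ℝ) ^ (n + 1) := by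
      rw [← pow_add, Nat.add_sub_cancel' hj]
    rw [mul_div_assoc', ← mul_assoc, hpow, div_mul_div_comm]
  simp_rw [hterm, ← Finset.mul_sum, key, mul_zero]

end Engine

end Summit.KontsevichZagierPeriods.AbelContraction.RealHyperellipticSector

end
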